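import Summits.ValiantsHypothesis.ValiantsHypothesis.Theorems.LacunarySymmetroidMatrixDescartesPivotRankOneCriticalWindowsParallelTwoLaw
import Summits.ValiantsHypothesis.ValiantsHypothesis.Theorems.LacunarySymmetroidMatrixDescartesPivotRankOneCriticalWindowsOneSidedPipeline

/-!
# `MatrixDescartes` census — rank-one `(2,K)₁`: THE PARALLEL TWO-LETTER LAW IN CENSUS CURRENCY
# (pivot letter + two parallel letters beyond it ⇒ `pivotPosRoots ≤ 4`, by the one-sided pipeline with right budget `3`)

HONEST FRAMING.  Object-search cell `pub-symmetroid`, seat `val-sym-mdr-p1` (generation 25); helper file `--supports` the crux item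
stmt-ValiantsHypothesis-18050 (`Theses.LacunarySymmetroid.MatrixDescartes`, OPEN, on HOLD) with NO closure claim.  ASSEMBLY ONLY: the
per-side critical-direction law `…ParallelTwoLaw.parallel_two_law` (two parallel letters beyond the pivot letter ⇒ no four critical points
beyond it) is read through the one-sided pipeline `…OneSidedPipeline.pivotPosRoots_le_add_one_of_letters_right` (`Z₊ ≤ C_R + 1`) as a
ROOT COUNT of the `K = 3` hyperbolic normal form: pivot letter at position `c ∈ (0,1)` with exponent `d₀ < e`, two letters at the common
position `1` with exponents `e < d₁ < d₂`, positive weights ⇒ **`pivotPosRoots e d J P ≤ 4`** (`parallelTwo_pivotPosRoots_le_four`).  The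
number `4 = 2(K−1)` is ALREADY IN THE TREE for this pencil — `Pivot.TwoDirections.posRoots_le_of_one_against_parallel` (generation 12,
Descartes; it covers the present row: `J = [[0,1],[1,0]]` has `det J ≤ 0` and its hard-cell inequalities read `−2t ≤ 0`) — so NO number is
added here; what is new is the ROUTE (critical directions ⇒ roots), written out once as the template for
every later per-side law of this lineage (`critical_fin_three_toLaw` converts the census-format critical equations into the law's format;
`exists_four_sorted` extracts sorted scales).  Nothing here bears on `MatrixDescartes` in its window, on `DoorA26` / `DoorA34`, registers / ζ,
or `VP ≠ VNP`.

[folklore] `Finset.exists_subset_card_eq` / `orderEmbOfFin`, `Fin.sum_univ_three`; tree theorems named above.  No definitions, no named facts.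
-/

-- `Summit.ValiantsHypothesis.ValiantsHypothesis.…` repeats a component by the D-0017 layout
-- (single-conjunct summit), which the `dupNamespace` linter flags; the name is mandated.
set_option linter.dupNamespace false

namespace Summit.ValiantsHypothesis.ValiantsHypothesis.Theorems.LacunarySymmetroidMatrixDescartes.Pivot.CriticalWindows.ParallelTwo

open Polynomial Finset Set Matrix
open scoped BigOperators
open Summit.ValiantsHypothesis.ValiantsHypothesis.Theorems.LacunarySymmetroidMatrixDescartes.Pivot (pivotPosRoots)
open Summit.ValiantsHypothesis.ValiantsHypothesis.Theorems.LacunarySymmetroidMatrixDescartes.Pivot.CriticalWindows.OneSidedPipeline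
  (pivotPosRoots_le_add_one_of_letters_right)

/-- Four elements of a finite set of reals with at least four elements, in increasing order. [folklore] -/
theorem exists_four_sorted (S : Finset ℝ) (hS : 4 ≤ S.card) :
    ∃ x₁ ∈ S, ∃ x₂ ∈ S, ∃ x₃ ∈ S, ∃ x₄ ∈ S, x₁ < x₂ ∧ x₂ < x₃ ∧ x₃ < x₄ := by
  classical
  obtain ⟨S', hS'S, hcard⟩ := Finset.exists_subset_card_eq hS
  set r := S'.orderEmbOfFin hcard
  have hmem : ∀ i, r i ∈ S := fun i => hS'S (Finset.orderEmbOfFin_mem _ _ _)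
  exact ⟨r 0, hmem 0, r 1, hmem 1, r 2, hmem 2, r 3, hmem 3, r.strictMono (by decide), r.strictMono (by decide),
    r.strictMono (by decide)⟩

/-- **THE CRITICAL EQUATIONS OF THE `Fin 3` PARALLEL PENCIL IN THE LAW'S FORMAT.**  Letters `0` (pivot: weight `w₀`, position `c`, exponent
`d₀ < e`), `1`, `2` (weights `w₁, w₂`, common position `1`, exponents `e < d₁, d₂`): the two critical equations of the window profile at
`(x, T)` in the `Fin 3` census format are the hypotheses `cᵢ`, `cᵢ'` of `parallel_two_law` with `dₚ = d₀`, `γᵢ = dᵢ − d₀`, `a = e − d₀`,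
`bᵢ = dᵢ − e`. [this file] -/
theorem critical_fin_three_toLaw {e d₀ d₁ d₂ : ℕ} {w₀ w₁ w₂ c x T : ℝ} (hd₀ : d₀ < e) (hd₁ : e < d₁) (hd₂ : e < d₂)
    (h1 : ∑ m, ![w₀, w₁, w₂] m * x ^ ![d₀, d₁, d₂] m * (T ^ 2 - ![c, 1, 1] m ^ 2) = 0)
    (h2 : ∑ m, ((![d₀, d₁, d₂] m : ℝ) - e) * (![w₀, w₁, w₂] m * x ^ ![d₀, d₁, d₂] m) * (T - ![c, 1, 1] m) ^ 2 = 0) :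
    (w₀ * x ^ d₀ * (T ^ 2 - c ^ 2) + (w₁ * x ^ (d₀ + (d₁ - d₀)) + w₂ * x ^ (d₀ + (d₂ - d₀))) * (T ^ 2 - 1 ^ 2) = 0) ∧
    (-((e : ℝ) - d₀) * (w₀ * x ^ d₀) * (T - c) ^ 2
      + (((d₁ : ℝ) - e) * (w₁ * x ^ (d₀ + (d₁ - d₀))) + ((d₂ : ℝ) - e) * (w₂ * x ^ (d₀ + (d₂ - d₀)))) * (T - 1) ^ 2 = 0) := by
  have e₁ : d₀ + (d₁ - d₀) = d₁ := by omega
  have e₂ : d₀ + (d₂ - d₀) = d₂ := by omega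
  rw [e₁, e₂]
  simp only [Fin.sum_univ_three, Matrix.cons_val_zero, Matrix.cons_val_one, Matrix.cons_val_two, Matrix.head_cons,
    Matrix.tail_cons] at h1 h2
  constructor
  · linear_combination h1
  · linear_combination h2

/-- **THE PARALLEL TWO-LETTER PENCIL HAS AT MOST FOUR POSITIVE ROOTS (census currency).**  `K = 3` rank-one letters in the hyperbolic
normal form: the pivot letter at position `c ∈ (0,1)` with exponent `d₀ < e`, two PARALLEL letters at position `1` with exponents
`e < d₁ < d₂`, all weights positive ⇒ `pivotPosRoots e d J P ≤ 4`.  Assembly: the one-sided pipeline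
(`OneSidedPipeline.pivotPosRoots_le_add_one_of_letters_right`, `Z₊ ≤ C_R + 1`) with right budget `3` from `parallel_two_law` (four scales
carrying right critical points, sorted by `exists_four_sorted`, are forbidden).  The number `4` itself is classical for this pencil (`2(K−1)`);
the number is the tree's `TwoDirections.posRoots_le_of_one_against_parallel` at `K = 3`; the point is the route — the template by which every per-side
critical-direction law is read as a root count. [this file] -/
theorem parallelTwo_pivotPosRoots_le_four (e d₀ d₁ d₂ : ℕ) (w₀ w₁ w₂ c : ℝ) (hw₀ : 0 < w₀) (hw₁ : 0 < w₁) (hw₂ : 0 < w₂)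
    (hc : 0 < c) (hc1 : c < 1) (hd₀ : d₀ < e) (hd₁ : e < d₁) (hd₁₂ : d₁ < d₂) :
    pivotPosRoots e ![d₀, d₁, d₂] (!![(0 : ℝ), 1; 1, 0])
      (fun k => ![w₀, w₁, w₂] k • vecMulVec ![1, ![c, 1, 1] k] ![1, ![c, 1, 1] k]) ≤ 4 := by
  have hd₂ : e < d₂ := hd₁.trans hd₁₂
  have hw : ∀ m : Fin 3, 0 < ![w₀, w₁, w₂] m := by
    intro m; fin_cases m <;> simp [hw₀, hw₁, hw₂]
  have ht : ∀ m : Fin 3, 0 < ![c, (1 : ℝ), 1] m := by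
    intro m; fin_cases m <;> simp [hc]
  have hdp : ![d₀, d₁, d₂] 0 < e := by simpa using hd₀
  have hdm : ∀ m : Fin 3, m ≠ 0 → e < ![d₀, d₁, d₂] m := by
    intro m hm; fin_cases m
    · exact absurd rfl hm
    · simpa using hd₁
    · simpa using hd₂
  have hnp : ∃ m : Fin 3, ![c, (1 : ℝ), 1] m ≠ ![c, (1 : ℝ), 1] 0 := ⟨1, by simp; exact hc1.ne'⟩
  have hright : ∀ m : Fin 3, m ≠ 0 → ![c, (1 : ℝ), 1] 0 < ![c, (1 : ℝ), 1] m := by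
    intro m hm; fin_cases m
    · exact absurd rfl hm
    · simpa using hc1
    · simpa using hc1
  have h := pivotPosRoots_le_add_one_of_letters_right 3 e ![d₀, d₁, d₂] ![w₀, w₁, w₂] ![c, 1, 1] 0 hw ht hdp hdm hnp hright 3 ?_
  · simpa using h
  intro S hS
  by_contra hlt
  have hS4 : 4 ≤ S.card := by omega
  obtain ⟨x₁, hx₁S, x₂, hx₂S, x₃, hx₃S, x₄, hx₄S, h₁₂, h₂₃, h₃₄⟩ := exists_four_sorted S hS4
  obtain ⟨hx₁, T₁, hT₁, k₁, k₁'⟩ := hS x₁ hx₁S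
  obtain ⟨-, T₂, hT₂, k₂, k₂'⟩ := hS x₂ hx₂S
  obtain ⟨-, T₃, hT₃, k₃, k₃'⟩ := hS x₃ hx₃S
  obtain ⟨-, T₄, hT₄, k₄, k₄'⟩ := hS x₄ hx₄S
  simp only [Matrix.cons_val_zero] at hT₁ hT₂ hT₃ hT₄
  obtain ⟨c₁, c₁'⟩ := critical_fin_three_toLaw hd₀ hd₁ hd₂ k₁ k₁'
  obtain ⟨c₂, c₂'⟩ := critical_fin_three_toLaw hd₀ hd₁ hd₂ k₂ k₂'
  obtain ⟨c₃, c₃'⟩ := critical_fin_three_toLaw hd₀ hd₁ hd₂ k₃ k₃'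
  obtain ⟨c₄, c₄'⟩ := critical_fin_three_toLaw hd₀ hd₁ hd₂ k₄ k₄'
  have ha : (0 : ℝ) < (e : ℝ) - d₀ := by
    have : (d₀ : ℝ) < e := by exact_mod_cast hd₀
    linarith
  have hb₁ : (0 : ℝ) < (d₁ : ℝ) - e := by
    have : (e : ℝ) < d₁ := by exact_mod_cast hd₁
    linarith
  have hb₁₂ : (d₁ : ℝ) - e < (d₂ : ℝ) - e := by
    have : (d₁ : ℝ) < d₂ := by exact_mod_cast hd₁₂
    linarith
  have hγ₁ : ((d₁ - d₀ : ℕ) : ℝ) = ((e : ℝ) - d₀) + ((d₁ : ℝ) - e) := by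
    rw [Nat.cast_sub (by omega)]; ring
  have hγ₂ : ((d₂ - d₀ : ℕ) : ℝ) = ((e : ℝ) - d₀) + ((d₂ : ℝ) - e) := by
    rw [Nat.cast_sub (by omega)]; ring
  exact parallel_two_law hw₀ hw₁ hw₂ hc hc1 ha hb₁ hb₁₂ hγ₁ hγ₂ hx₁ h₁₂ h₂₃ h₃₄ hT₁ hT₂ hT₃ hT₄
    c₁ c₁' c₂ c₂' c₃ c₃' c₄ c₄'

end Summit.ValiantsHypothesis.ValiantsHypothesis.Theorems.LacunarySymmetroidMatrixDescartes.Pivot.CriticalWindows.ParallelTwo
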